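import Summits.Parity.GeneralizedHardyLittlewood.Theorems.LeeYangFibresModelHyperbolicityDefs
import HarnessLib

/-!
# Stub `stub_calculus` of line `window-chain-transport` (crux `LeeYangFibres.ModelHyperbolicity`)

Crux item stmt-Parity-14110. We prove `DensityCalculus`, the elementary calculus of the
Alladi–Buchstab cell densities `cellDensity j u = I_{j+1}(u)` (`I_1 ≡ 1`,
`I_{j+2}(u) = ∫_1^{max(u-1,1)} I_{j+1}(t) dt/t`) and of the model family
`modelEval N u z = G_N(u;z) = Σ_{j<N} I_{j+1}(u) z^j`:

* (C2) `I_{j+2}(u) = 0` for `u ≤ j+2` — induction on `j`: the integrand vanishes on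
  `[1, max(u-1,1)]`;
* (C1) continuity of every `I_{j+1}` — induction: on `[1, ∞)` the integrand `I_{j+1}(t)/t`
  agrees with the *regularised* integrand `I_{j+1}(t)/max(t,1)`, which is continuous on all of
  `ℝ`, so `intervalIntegral.continuous_primitive` applies and we compose with `u ↦ max(u-1,1)`;
* nonnegativity and (C3) positivity `I_{j+1}(u) > 0` for `u > j+1` — induction, comparing the
  integral with `∫ 0` (`integral_lt_integral_of_continuousOn_of_le_of_exists_lt`);
* (C4) the FTC `I_{j+2}'(u) = I_{j+1}(u-1)/(u-1)` for `u > 2` —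
  `intervalIntegral.integral_hasDerivAt_right`, the shift `w ↦ w - 1`, and `max(w-1,1) = w-1`
  near `u`;
* (C5) continuity of `τ ↦ G_N(τ;z)` — finite sum;
* (C6) the delay equation `∂_τ G_N(τ;z) = z G_N(τ-1;z)/(τ-1)` for `2 < τ ≤ N+1`, `N ≥ 2`
  — termwise (C4), the top term of `G_N(τ-1;z)` vanishing by (C2);
* (C7) the Volterra identity
  `G_N(s;z) - G_N(σ;z) = z ∫_{max(σ-1,1)}^{max(s-1,1)} G_N(τ;z) dτ/τ`
  for `1 ≤ σ ≤ s ≤ N+1`, `N ≥ 2` — directly from the definition (difference of primitives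
  termwise, `intervalIntegral.integral_finsetSum`, and again the vanishing top term).

References: K. Alladi, *The distribution of `ν(n)` in the sieve of Eratosthenes*, Quart. J. Math.
Oxford (2) 33 (1982), 129–148; G. Tenenbaum, *Introduction to analytic and probabilistic number
theory*, III.6. (Only standard calculus is used; no named facts.)
-/

noncomputable section

namespace Summit.Parity.GeneralizedHardyLittlewood.Cruxes.ModelHyperbolicity.WindowChainTransport

open scoped BigOperators Topology
open Filter Set MeasureTheory

/-! ## Helper lemmas (tag `calc_`) -/

/-- The recursion unfolded: `I_{j+2}(u) = ∫_1^{max(u-1,1)} I_{j+1}(t) dt/t`. -/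
theorem calc_cellDensity_succ (j : ℕ) (u : ℝ) :
    cellDensity (j + 1) u = ∫ t in (1 : ℝ)..max (u - 1) 1, cellDensity j t / t := by
  rw [cellDensity]

/-- **(C2)** `I_{j+2}(u) = 0` for `u ≤ j + 2`. -/
theorem calc_cellDensity_succ_eq_zero (j : ℕ) :
    ∀ u : ℝ, u ≤ (j : ℝ) + 2 → cellDensity (j + 1) u = 0 := by
  induction j with
  | zero =>
    intro u hu
    exact cellDensity_succ_of_le_two 0 (by simpa using hu)
  | succ j ih =>
    intro u hu
    rw [calc_cellDensity_succ]
    have h : EqOn (fun t : ℝ => cellDensity (j + 1) t / t) (fun _ => 0)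
        (uIcc (1 : ℝ) (max (u - 1) 1)) := by
      intro t ht
      rw [uIcc_of_le (le_max_right _ _)] at ht
      have hj : (0 : ℝ) ≤ j := j.cast_nonneg
      have htj : t ≤ (j : ℝ) + 2 := by
        rcases le_max_iff.mp ht.2 with h | h
        · push_cast at hu; linarith
        · linarith
      simp only
      rw [ih t htj, zero_div]
    rw [intervalIntegral.integral_congr h]
    exact intervalIntegral.integral_zero

/-- The *regularised* recursion: on `[1, ∞)` the integrand `I_{j+1}(t)/t` equals
`I_{j+1}(t)/max(t,1)`, so `I_{j+2}(u) = ∫_1^{max(u-1,1)} I_{j+1}(t)/max(t,1) dt`. -/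
theorem calc_cellDensity_succ_eq (j : ℕ) (u : ℝ) :
    cellDensity (j + 1) u = ∫ t in (1 : ℝ)..max (u - 1) 1, cellDensity j t / max t 1 := by
  rw [calc_cellDensity_succ]
  refine intervalIntegral.integral_congr fun t ht => ?_
  rw [uIcc_of_le (le_max_right _ _)] at ht
  rw [max_eq_left ht.1]

/-- The regularised integrand `I_{j+1}(t)/max(t,1)` is continuous on `ℝ` once `I_{j+1}` is. -/
theorem calc_continuous_integrand {j : ℕ} (h : Continuous (cellDensity j)) :
    Continuous fun t : ℝ => cellDensity j t / max t 1 :=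
  h.div (continuous_id.max continuous_const) fun t =>
    (lt_of_lt_of_le one_pos (le_max_right t 1)).ne'

/-- **(C1)** every `I_{j+1}` is continuous on `ℝ`. -/
theorem calc_continuous (j : ℕ) : Continuous (cellDensity j) := by
  induction j with
  | zero =>
    have h : cellDensity 0 = fun _ => (1 : ℝ) := funext cellDensity_zero
    rw [h]
    exact continuous_const
  | succ j ih =>
    have hg := calc_continuous_integrand ih
    have hF : Continuous fun w : ℝ => ∫ t in (1 : ℝ)..w, cellDensity j t / max t 1 :=
      intervalIntegral.continuous_primitive (fun a b => hg.intervalIntegrable a b) 1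
    have heq : cellDensity (j + 1) =
        fun u => ∫ t in (1 : ℝ)..max (u - 1) 1, cellDensity j t / max t 1 :=
      funext (calc_cellDensity_succ_eq j)
    rw [heq]
    exact hF.comp ((continuous_id.sub continuous_const).max continuous_const)

/-- `I_{j+1} ≥ 0` everywhere. -/
theorem calc_nonneg (j : ℕ) : ∀ u : ℝ, 0 ≤ cellDensity j u := by
  induction j with
  | zero => intro u; rw [cellDensity_zero]; exact zero_le_one
  | succ j ih =>
    intro u
    rw [calc_cellDensity_succ]
    exact intervalIntegral.integral_nonneg (le_max_right _ _) fun t ht =>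
      div_nonneg (ih t) (by linarith [ht.1])

/-- **(C3)** `I_{j+1}(u) > 0` for `u > j + 1`. -/
theorem calc_pos (j : ℕ) : ∀ u : ℝ, (j : ℝ) + 1 < u → 0 < cellDensity j u := by
  induction j with
  | zero => intro u _; rw [cellDensity_zero]; exact one_pos
  | succ j ih =>
    intro u hu
    push_cast at hu
    have hj : (0 : ℝ) ≤ j := j.cast_nonneg
    have hu1 : 1 < u - 1 := by linarith
    rw [calc_cellDensity_succ_eq, max_eq_left hu1.le]
    have hg := calc_continuous_integrand (calc_continuous j)
    have key := intervalIntegral.integral_lt_integral_of_continuousOn_of_le_of_exists_lt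
      (f := fun _ => (0 : ℝ)) (g := fun t : ℝ => cellDensity j t / max t 1) hu1
      continuousOn_const hg.continuousOn
      (fun x _ => div_nonneg (calc_nonneg j x) (le_trans zero_le_one (le_max_right x 1)))
      ⟨u - 1, right_mem_Icc.mpr hu1.le, div_pos (ih (u - 1) (by linarith))
        (lt_of_lt_of_le one_pos (le_max_right _ _))⟩
    rwa [intervalIntegral.integral_zero] at key

/-- **(C4)** FTC: `I_{j+2}'(u) = I_{j+1}(u-1)/(u-1)` for `u > 2`. -/
theorem calc_hasDerivAt (j : ℕ) {u : ℝ} (hu : 2 < u) :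
    HasDerivAt (cellDensity (j + 1)) (cellDensity j (u - 1) / (u - 1)) u := by
  have hg := calc_continuous_integrand (calc_continuous j)
  have hF : HasDerivAt (fun w => ∫ t in (1 : ℝ)..w, cellDensity j t / max t 1)
      (cellDensity j (u - 1) / max (u - 1) 1) (u - 1) :=
    intervalIntegral.integral_hasDerivAt_right (hg.intervalIntegrable _ _)
      (hg.stronglyMeasurableAtFilter _ _) hg.continuousAt
  rw [max_eq_left (by linarith : (1 : ℝ) ≤ u - 1)] at hF
  have hcomp : HasDerivAt (fun w => ∫ t in (1 : ℝ)..(w - 1), cellDensity j t / max t 1)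
      (cellDensity j (u - 1) / (u - 1)) u :=
    hF.comp_sub_const u 1
  refine hcomp.congr_of_eventuallyEq ?_
  filter_upwards [Ioi_mem_nhds hu] with w (hw : 2 < w)
  rw [calc_cellDensity_succ_eq, max_eq_left (by linarith)]

/-- **(C5)** `τ ↦ G_N(τ;z)` is continuous. -/
theorem calc_continuous_modelEval (N : ℕ) (z : ℂ) :
    Continuous fun τ : ℝ => modelEval N τ z := by
  unfold modelEval
  refine continuous_finsetSum _ fun j _ => ?_
  exact (Complex.continuous_ofReal.comp (calc_continuous j)).mul continuous_const

/-- **(C6)** the delay equation `∂_τ G_N(τ;z) = z G_N(τ-1;z)/(τ-1)` for `2 < τ ≤ N+1`,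
`N ≥ 2`. -/
theorem calc_hasDerivAt_modelEval {N : ℕ} (hN : 2 ≤ N) (z : ℂ) {τ : ℝ} (hτ : 2 < τ)
    (hτN : τ ≤ (N : ℝ) + 1) :
    HasDerivAt (fun t : ℝ => modelEval N t z)
      (z * modelEval N (τ - 1) z / ((τ : ℂ) - 1)) τ := by
  obtain ⟨K, rfl⟩ : ∃ K, N = K + 1 + 1 := ⟨N - 2, by omega⟩
  have hfun : (fun t : ℝ => modelEval (K + 1 + 1) t z) =
      fun t => ∑ i ∈ Finset.range (K + 1), (cellDensity (i + 1) t : ℂ) * z ^ (i + 1) + 1 := by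
    funext t
    unfold modelEval
    rw [Finset.sum_range_succ']
    simp
  have hderiv : HasDerivAt
      (fun t : ℝ =>
        ∑ i ∈ Finset.range (K + 1), (cellDensity (i + 1) t : ℂ) * z ^ (i + 1) + 1)
      (∑ i ∈ Finset.range (K + 1),
        ((cellDensity i (τ - 1) / (τ - 1) : ℝ) : ℂ) * z ^ (i + 1)) τ := by
    refine (HasDerivAt.fun_sum fun i _ => ?_).add_const 1
    exact (calc_hasDerivAt i hτ).ofReal_comp.mul_const _
  rw [hfun]
  refine hderiv.congr_deriv ?_
  have htop : cellDensity (K + 1) (τ - 1) = 0 :=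
    calc_cellDensity_succ_eq_zero K (τ - 1) (by push_cast at hτN; linarith)
  have hτ1 : (τ : ℂ) - 1 ≠ 0 := by
    rw [← Complex.ofReal_one, ← Complex.ofReal_sub]
    exact Complex.ofReal_ne_zero.mpr (by linarith)
  unfold modelEval
  rw [Finset.sum_range_succ _ (K + 1), htop, Complex.ofReal_zero, zero_mul, add_zero,
    Finset.mul_sum, Finset.sum_div]
  refine Finset.sum_congr rfl fun i _ => ?_
  rw [Complex.ofReal_div, Complex.ofReal_sub, Complex.ofReal_one]
  field_simp
  ring

/-- **(C7)** the Volterra identity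
`G_N(s;z) - G_N(σ;z) = z ∫_{max(σ-1,1)}^{max(s-1,1)} G_N(τ;z) dτ/τ` for `σ ≤ s ≤ N+1`,
`N ≥ 2` (the hypothesis `1 ≤ σ` of (C7) is not needed: below `2` everything is constant). -/
theorem calc_volterra {N : ℕ} (hN : 2 ≤ N) (z : ℂ) {σ s : ℝ} (hσs : σ ≤ s)
    (hs : s ≤ (N : ℝ) + 1) :
    modelEval N s z - modelEval N σ z =
      z * ∫ τ in max (σ - 1) 1..max (s - 1) 1, modelEval N τ z / (τ : ℂ) := by
  obtain ⟨K, rfl⟩ : ∃ K, N = K + 1 + 1 := ⟨N - 2, by omega⟩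
  have hK : (0 : ℝ) ≤ K := K.cast_nonneg
  push_cast at hs
  set a : ℝ := max (σ - 1) 1 with ha
  set b : ℝ := max (s - 1) 1 with hb
  have ha1 : 1 ≤ a := le_max_right _ _
  have hab : a ≤ b := max_le_max (by linarith) le_rfl
  have hbK : b ≤ (K : ℝ) + 2 := max_le (by linarith) (by linarith)
  have hg : ∀ i : ℕ, Continuous fun t : ℝ => cellDensity i t / max t 1 := fun i =>
    calc_continuous_integrand (calc_continuous i)
  -- the left-hand side, termwise
  have hL : modelEval (K + 1 + 1) s z - modelEval (K + 1 + 1) σ z =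
      ∑ i ∈ Finset.range (K + 1),
        ((∫ t in a..b, cellDensity i t / max t 1 : ℝ) : ℂ) * z ^ (i + 1) := by
    unfold modelEval
    rw [← Finset.sum_sub_distrib, Finset.sum_range_succ']
    simp only [cellDensity_zero, sub_self, add_zero]
    refine Finset.sum_congr rfl fun i _ => ?_
    rw [← sub_mul, ← Complex.ofReal_sub, calc_cellDensity_succ_eq, calc_cellDensity_succ_eq,
      intervalIntegral.integral_interval_sub_left ((hg i).intervalIntegrable _ _)
        ((hg i).intervalIntegrable _ _)]
  -- the right-hand side, termwise
  have hR : ∫ τ in a..b, modelEval (K + 1 + 1) τ z / (τ : ℂ) =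
      ∑ i ∈ Finset.range (K + 1 + 1),
        ((∫ t in a..b, cellDensity i t / max t 1 : ℝ) : ℂ) * z ^ i := by
    have hcongr : EqOn (fun τ : ℝ => modelEval (K + 1 + 1) τ z / (τ : ℂ))
        (fun τ =>
          ∑ i ∈ Finset.range (K + 1 + 1), ((cellDensity i τ / max τ 1 : ℝ) : ℂ) * z ^ i)
        (uIcc a b) := by
      intro τ hτ
      rw [uIcc_of_le hab] at hτ
      have hτ1 : 1 ≤ τ := ha1.trans hτ.1
      simp only
      unfold modelEval
      rw [Finset.sum_div]
      refine Finset.sum_congr rfl fun i _ => ?_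
      rw [max_eq_left hτ1, Complex.ofReal_div]
      ring
    rw [intervalIntegral.integral_congr hcongr, intervalIntegral.integral_finsetSum]
    · refine Finset.sum_congr rfl fun i _ => ?_
      rw [intervalIntegral.integral_mul_const, intervalIntegral.integral_ofReal]
    · intro i _
      exact
        ((Complex.continuous_ofReal.comp (hg i)).mul continuous_const).intervalIntegrable _ _
  -- the top term vanishes by (C2)
  have htop : ∫ t in a..b, cellDensity (K + 1) t / max t 1 = 0 := by
    have h0 : EqOn (fun t : ℝ => cellDensity (K + 1) t / max t 1) (fun _ => 0) (uIcc a b) := by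
      intro t ht
      rw [uIcc_of_le hab] at ht
      simp only
      rw [calc_cellDensity_succ_eq_zero K t (by linarith [ht.2]), zero_div]
    rw [intervalIntegral.integral_congr h0]
    exact intervalIntegral.integral_zero
  rw [hL, hR, Finset.sum_range_succ _ (K + 1), htop, Complex.ofReal_zero, zero_mul, add_zero,
    Finset.mul_sum]
  refine Finset.sum_congr rfl fun i _ => ?_
  ring

/-! ## The registered stub (name and statement EXACTLY as registered) -/

/-- **`stub_calculus` (registered).** The calculus (C1)–(C7) of the Alladi–Buchstab cell
densities `I_{j+1}` and of the model family `G_N(τ;z)`: continuity, vanishing below the diagonal,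
positivity above it, the FTC derivative, continuity of `G_N` in `τ`, the delay equation, and its
Volterra form. -/
theorem stub_calculus : DensityCalculus :=
  ⟨calc_continuous, calc_cellDensity_succ_eq_zero, calc_pos, fun j _ hu => calc_hasDerivAt j hu,
    calc_continuous_modelEval, fun _ hN z _ hτ hτN => calc_hasDerivAt_modelEval hN z hτ hτN,
    fun _ hN z _ _ _ hσs hs => calc_volterra hN z hσs hs⟩

end Summit.Parity.GeneralizedHardyLittlewood.Cruxes.ModelHyperbolicity.WindowChainTransport

end
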